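import Mathlib
import Summits.NavierStokesRegularity.NavierStokesRegularity.Theorems.EulerZoomLiouvillePowerGaugeEulerLiouvilleCasimirFloorEndgameTools
import Summits.NavierStokesRegularity.NavierStokesRegularity.Theorems.EulerZoomLiouvillePowerGaugeEulerLiouvillePastIrrotational
import Literature.Analysis.FluidPDE.ClassicalSolution
import Literature.Analysis.FluidPDE.AxisymmetricEuler
import Literature.Analysis.FluidPDE.VorticityCalculus
import HarnessLib

/-!
# Crux `EulerZoomLiouville.PowerGaugeEulerLiouville` (stmt-NavierStokesRegularity-19832), line `casimir-floor`, stub K3 — part 2: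
# THE FLOOR ENDGAME — Casimir floor + persistent ledger blobs + the `E`-gauge force an irrotational past, hence a trivial member

Route №10 `EulerZoomLiouville` (NavierStokesRegularity), crux E.  Line `casimir-floor` (ideator ns-idea-11 g3;
`Cruxes/PowerGaugeEulerLiouville/Lines/casimir_floor.lean`), registered stub `stub_floorEndgame` (K3), proved here with its signature
UNFOLDED in the tree's vocabulary (the line's `CasimirFloor`, `InClass`, `IsSwirlFreeDriftingWith`, `LedgerBlobsPersist`, `driftRadius`,
`VanishesAE`, `axisLedger v x = ‖curl v x‖ / cylRadius x` are `def`s of the Cruxes file; the statement below is their `δ`-unfolding, so the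
skeleton fills the stub by `theorem stub_floorEndgame : Sig.stub_floorEndgame := vanishesAE_of_casimirFloor_of_blobsPersist`).

THE ARGUMENT.  GIVEN the Casimir floor (K2, landed as `CasimirFloor.casimirFloor`), a member `(u,p,H,c)` of the power-gauged class
(`0 < ρ ≤ 1/2`) which is classical, axisymmetric swirl-free with drift data `(M, κ)`, `(1−ρ)/(2−ρ) < κ < 1`, and whose ledger blobs persist
(K1, landed as `CasimirFloor.ledgerBlobsPersist_of_swirlFreeDriftingWith`), is trivial.  By the lead's landed filler
`PastIrrotational.ae_eq_zero_of_gauge_of_pastIrrotational` (`T₁ = 0`) it suffices that every past slice be irrotational.  If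
`curl u(t₀) ≢ 0` (`t₀ < 0`), part 1 gives an off-axis blob `B(x₀, δ)` with density `≤ W` and mass `≥ m > 0`.  For `a` large and every
`t₁ ∈ (−L_a, t₀)`, `L_a = min (a², (c₁ a)^{1/(1−κ)})`, `c₁ = (1−κ)/(4(M+1))`, the avatar `T(t₁)` of K1 lies in
`B(0, ‖x₀‖ + δ + M(−t₁)^{1−κ}/(1−κ)) ⊆ B(0, a)` (drift `≤ a/4`, `‖x₀‖ + δ ≤ a/2`), so the floor gives
`∫_{B(a)} |curl u(t₁)|² ≥ F_a = m² / (8 π a (2 + log⁺(a³W/m)))`; integrating over `t₁` and comparing with the windowed enstrophy budget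
`∫_{−a²}^{0}∫_{B(a)} |curl u|² ≤ 16 c a^{1−ρ}` (part 1): `(L_a − |t₀|) F_a ≤ 16 c a^{1−ρ}`.  With `L_a ≥ 2|t₀|`, `L_a ≥ c₂ a^γ`,
`γ = min (2, 1/(1−κ))`, and `2 + log⁺(a³W/m) ≤ (5 + |log(W/m)|) log a` this reads `a^{γ−(2−ρ)} ≤ K₁ log a` for all large `a`, which is absurd
since `γ − (2−ρ) > 0` — the EXPONENT RACE `min(2, 1/(1−κ)) > 2 − ρ ⇔ κ > (1−ρ)/(2−ρ)` (and `ρ > 0`) — and `log a = o(a^ε)`.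

* **`vanishesAE_of_casimirFloor_of_blobsPersist`** — the stub signature, unfolded.

WHAT THIS IS NOT: not NS, not the crux — a helper `--supports` stmt-19832 on the line `casimir-floor`: the STRATUM THEOREM
`InClass ∧ (classical axisymmetric swirl-free, drift exponent κ > (1−ρ)/(2−ρ)) → u = 0 a.e.` modulo the line's two landed stubs, i.e. a
statement about a hypothetical Euler zoom-limit class; the residue K4 (`stub_fastDriftRest`, members outside the stratum) stays OPEN;
no summit statement is proved here and nothing here bears on NS regularity itself.  [folklore]
-/

noncomputable section

-- flat `Theorems/<Route><Decl>…` files of one crux share the namespace of the crux (tree convention)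
set_option linter.dupNamespace false

open MeasureTheory Set Filter Topology Metric Function
open scoped NNReal ENNReal

namespace Summit.NavierStokesRegularity.NavierStokesRegularity.Theorems.PowerGaugeEulerLiouville.CasimirFloor

open Literature.Analysis Literature.Analysis.FluidPDE
open Summit.NavierStokesRegularity.NavierStokesRegularity.Theorems.PowerGaugeEulerLiouville.SwirlfreeLedger

open scoped Real

/-! ### Real-variable bookkeeping (kept out of the main proof) -/

/-- The backward drift over the usable window is at most `a/4`: with `c₁ = (1−κ)/(4(M+1))` and `−t₁ ≤ (c₁ a)^{1/(1−κ)}`,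
`M((−t₁)^{1−κ} − (−t₀)^{1−κ})/(1−κ) ≤ M c₁ a/(1−κ) = (M/(M+1)) · a/4 ≤ a/4`. [folklore] -/
theorem drift_le_quarter {M κ c₁ a t₀ t₁ : ℝ} (hM0 : 0 ≤ M) (h1κ : 0 < 1 - κ) (hc₁ : c₁ = (1 - κ) / (4 * (M + 1)))
    (ha : 0 < a) (ht₁ : 0 ≤ -t₁) (ht₀ : 0 ≤ -t₀) (hle : -t₁ ≤ (c₁ * a) ^ (1 - κ)⁻¹) :
    M / (1 - κ) * ((-t₁) ^ (1 - κ) - (-t₀) ^ (1 - κ)) ≤ a / 4 := by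
  have hc₁0 : 0 < c₁ := by rw [hc₁]; positivity
  have h1 : (-t₁) ^ (1 - κ) ≤ c₁ * a := by
    have h := Real.rpow_le_rpow ht₁ hle h1κ.le
    rwa [Real.rpow_inv_rpow (by positivity) h1κ.ne'] at h
  have h2 : 0 ≤ (-t₀) ^ (1 - κ) := Real.rpow_nonneg ht₀ _
  have e : M / (1 - κ) * (c₁ * a) = M / (M + 1) * (a / 4) := by
    rw [hc₁]
    field_simp
  have hM1 : M / (M + 1) ≤ 1 := div_le_one_of_le₀ (by linarith) (by linarith)
  calc M / (1 - κ) * ((-t₁) ^ (1 - κ) - (-t₀) ^ (1 - κ))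
      ≤ M / (1 - κ) * (c₁ * a) := mul_le_mul_of_nonneg_left (by linarith) (div_nonneg hM0 h1κ.le)
    _ = M / (M + 1) * (a / 4) := e
    _ ≤ 1 * (a / 4) := mul_le_mul_of_nonneg_right hM1 (by positivity)
    _ = a / 4 := one_mul _

/-- The usable window length `L_a = min (a², (c₁ a)^{1/(1−κ)})` is at least `c₂ a^γ` (`γ = min (2, 1/(1−κ)) ≥ 1`,
`c₂ = min (1, c₁^{1/(1−κ)})`), hence at least `2|t₀|` once `a ≥ 2|t₀|/c₂` (`a ≥ 1`). [folklore] -/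
theorem window_length_bounds {a κ c₁ c₂ γ t₀ : ℝ} (ha1 : 1 ≤ a) (hc₁0 : 0 < c₁) (hc₂0 : 0 < c₂) (hc₂1 : c₂ ≤ 1)
    (hc₂c : c₂ ≤ c₁ ^ (1 - κ)⁻¹) (hγ2 : γ ≤ 2) (hγκ : γ ≤ (1 - κ)⁻¹) (hγ1 : 1 ≤ γ) (hat : 2 * (-t₀) / c₂ ≤ a) :
    c₂ * a ^ γ ≤ min (a ^ 2) ((c₁ * a) ^ (1 - κ)⁻¹) ∧ 2 * (-t₀) ≤ min (a ^ 2) ((c₁ * a) ^ (1 - κ)⁻¹) := by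
  have ha0 : 0 < a := by linarith
  have haγ0 : 0 ≤ a ^ γ := Real.rpow_nonneg ha0.le _
  have hge : c₂ * a ^ γ ≤ min (a ^ 2) ((c₁ * a) ^ (1 - κ)⁻¹) := by
    refine le_min ?_ ?_
    · have h1 : a ^ γ ≤ a ^ (2 : ℝ) := Real.rpow_le_rpow_of_exponent_le ha1 hγ2
      rw [Real.rpow_two] at h1
      nlinarith
    · have h1 : a ^ γ ≤ a ^ (1 - κ)⁻¹ := Real.rpow_le_rpow_of_exponent_le ha1 hγκ
      have h3 : 0 ≤ c₁ ^ (1 - κ)⁻¹ := Real.rpow_nonneg hc₁0.le _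
      rw [Real.mul_rpow hc₁0.le ha0.le]
      nlinarith
  refine ⟨hge, le_trans ?_ hge⟩
  have h1 : a ≤ a ^ γ := by
    have h := Real.rpow_le_rpow_of_exponent_le ha1 hγ1
    rwa [Real.rpow_one] at h
  have h2 : 2 * (-t₀) ≤ c₂ * a := by have h := (div_le_iff₀ hc₂0).1 hat; linarith
  nlinarith

/-- `2 + log⁺ (a³ W / m) ≤ (5 + |log (W/m)|) log a` for `log a ≥ 1` (`a, W, m > 0`). [folklore] -/
theorem two_add_posLog_le {a W m : ℝ} (ha : 0 < a) (hW : 0 < W) (hm : 0 < m) (hloga : 1 ≤ Real.log a) :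
    2 + max 0 (Real.log (a ^ 3 * W / m)) ≤ (2 + |Real.log (W / m)| + 3) * Real.log a := by
  have hlog3 : Real.log (a ^ 3 * W / m) = 3 * Real.log a + Real.log (W / m) := by
    rw [mul_div_assoc, Real.log_mul (by positivity) (by positivity), Real.log_pow]
    norm_num
  have hmax : max 0 (Real.log (a ^ 3 * W / m)) ≤ 3 * Real.log a + |Real.log (W / m)| := by
    rw [hlog3]
    refine max_le ?_ ?_
    · positivity
    · linarith [le_abs_self (Real.log (W / m))]
  nlinarith [abs_nonneg (Real.log (W / m))]

/-- **The race, as arithmetic.**  From the floor `F · (8 π a L) = m²`, the budget `F (t₀ + L_a) ≤ K a^{1−ρ}`, the window bounds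
`2|t₀| ≤ L_a`, `c₂ a^γ ≤ L_a`, and `L ≤ C log a`: `a^{γ−(2−ρ)} ≤ (16 π K C/(c₂ m²)) log a`. [folklore] -/
theorem rpow_le_mul_log_of_floor_budget {a ρ γ c₂ m F La L t₀ K C : ℝ} (ha0 : 0 < a) (hm : 0 < m) (hc₂ : 0 < c₂)
    (hL0 : 0 < L) (hK : 0 ≤ K) (hF0 : 0 < F) (hF : F * (8 * π * a * L) = m ^ 2) (hbudget : F * (t₀ + La) ≤ K * a ^ (1 - ρ))
    (hLa_t₀ : 2 * (-t₀) ≤ La) (hLa_ge : c₂ * a ^ γ ≤ La) (hL : L ≤ C * Real.log a) :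
    a ^ (γ - (2 - ρ)) ≤ 16 * π * K * C / (c₂ * m ^ 2) * Real.log a := by
  have ha2ρ : a ^ (1 - ρ) * a = a ^ (2 - ρ) := by
    rw [show (2 : ℝ) - ρ = (1 - ρ) + 1 by ring, Real.rpow_add ha0, Real.rpow_one]
  have haγ : a ^ γ = a ^ (γ - (2 - ρ)) * a ^ (2 - ρ) := by
    rw [← Real.rpow_add ha0]
    congr 1
    ring
  have ha2ρ0 : 0 < a ^ (2 - ρ) := Real.rpow_pos_of_pos ha0 _
  -- `F · L_a ≤ 2 K a^{1-ρ}`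
  have h1 : F * La ≤ 2 * (K * a ^ (1 - ρ)) := by
    have h := mul_le_mul_of_nonneg_left hLa_t₀ hF0.le
    nlinarith
  -- `m² c₂ a^γ ≤ F L_a · 8 π a L ≤ 2 K a^{1-ρ} · 8 π a · C log a`
  have h8 : 0 ≤ 8 * π * a * L := by positivity
  have hC : 8 * π * a * L ≤ 8 * π * a * (C * Real.log a) := mul_le_mul_of_nonneg_left hL (by positivity)
  have hkey : m ^ 2 * (c₂ * a ^ γ) ≤ 16 * π * K * C * a ^ (2 - ρ) * Real.log a :=
    calc m ^ 2 * (c₂ * a ^ γ) ≤ m ^ 2 * La := mul_le_mul_of_nonneg_left hLa_ge (sq_nonneg _)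
      _ = F * La * (8 * π * a * L) := by rw [← hF]; ring
      _ ≤ 2 * (K * a ^ (1 - ρ)) * (8 * π * a * L) := mul_le_mul_of_nonneg_right h1 h8
      _ ≤ 2 * (K * a ^ (1 - ρ)) * (8 * π * a * (C * Real.log a)) := mul_le_mul_of_nonneg_left hC (by positivity)
      _ = 16 * π * K * C * (a ^ (1 - ρ) * a) * Real.log a := by ring
      _ = 16 * π * K * C * a ^ (2 - ρ) * Real.log a := by rw [ha2ρ]
  rw [haγ] at hkey
  rw [div_mul_eq_mul_div, le_div_iff₀ (by positivity)]
  have h := div_le_div_of_nonneg_right hkey ha2ρ0.le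
  have e1 : m ^ 2 * (c₂ * (a ^ (γ - (2 - ρ)) * a ^ (2 - ρ))) / a ^ (2 - ρ) = a ^ (γ - (2 - ρ)) * (c₂ * m ^ 2) := by
    field_simp
  have e2 : 16 * π * K * C * a ^ (2 - ρ) * Real.log a / a ^ (2 - ρ) = 16 * π * K * C * Real.log a := by
    field_simp
  rw [e1, e2] at h
  exact h

/-! ### The stub, unfolded -/

/-- **K3 `stub_floorEndgame` of the line `casimir-floor`, signature unfolded** (`CasimirFloor → ∀ ρ ∈ (0, 1/2], ∀ (u,p,H,c) ∈ InClass ρ,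
∀ M κ, (1−ρ)/(2−ρ) < κ → IsSwirlFreeDriftingWith u p M κ → LedgerBlobsPersist u M κ → VanishesAE u`, with the line's abbreviations
`δ`-unfolded): GIVEN the Casimir floor, a classical axisymmetric swirl-free member of the power-gauged class whose drift exponent beats the
threshold `(1−ρ)/(2−ρ)` and whose ledger blobs persist backward is trivial.  Proof in the module docstring (irrotational past by the
floor-versus-budget race, then the landed irrotational filler). [folklore] -/
theorem vanishesAE_of_casimirFloor_of_blobsPersist :
    (∀ (v : EuclideanSpace ℝ (Fin 3) → EuclideanSpace ℝ (Fin 3)) (T : Set (EuclideanSpace ℝ (Fin 3))) (a W m : ℝ),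
        ContDiff ℝ 1 v → 0 < a → 0 < W → 0 < m → MeasurableSet T → T ⊆ ball (0 : EuclideanSpace ℝ (Fin 3)) a →
        (∀ x ∈ T, ‖curl v x‖ / cylRadius x ≤ W) →
        ENNReal.ofReal m ≤ ∫⁻ x in T, ENNReal.ofReal (‖curl v x‖ / cylRadius x) →
          ENNReal.ofReal (m ^ 2 / (8 * π * a * (2 + max 0 (Real.log (a ^ 3 * W / m))))) ≤
            ∫⁻ x in T, ENNReal.ofReal (‖curl v x‖ ^ 2)) →
      ∀ ρ : ℝ, 0 < ρ → ρ ≤ 1 / 2 →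
        ∀ (u : ℝ → EuclideanSpace ℝ (Fin 3) → EuclideanSpace ℝ (Fin 3)) (p : ℝ → EuclideanSpace ℝ (Fin 3) → ℝ)
          (H : ℝ → EuclideanSpace ℝ (Fin 3) → EuclideanSpace ℝ (Fin 3) →L[ℝ] EuclideanSpace ℝ (Fin 3)) (c : ℝ≥0),
          (IsSuitableWeakSolutionOn (slab (EuclideanSpace ℝ (Fin 3)) (Set.Iio 0) isOpen_Iio) 0 0 u p ∧
              HasWeakSpatialGradientOn (slab (EuclideanSpace ℝ (Fin 3)) (Set.Iio 0) isOpen_Iio) u H ∧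
              (∀ a : ℝ, 0 < a →
                ENNReal.ofReal (a ^ (2 * ρ)) * cknA a (0 : ℝ × EuclideanSpace ℝ (Fin 3)) u +
                      ENNReal.ofReal (a ^ ρ) * cknE a (0 : ℝ × EuclideanSpace ℝ (Fin 3)) H +
                    ENNReal.ofReal (a ^ (2 * ρ)) * cknD a (0 : ℝ × EuclideanSpace ℝ (Fin 3)) p ≤ (c : ℝ≥0∞))) →
            ∀ M κ : ℝ, (1 - ρ) / (2 - ρ) < κ →
              (IsClassicalEulerSolutionOn (Set.Iio 0) 0 u p ∧
                  (∀ τ : ℝ, τ < 0 → IsAxisymmetric (u τ) ∧ HasNoSwirl (u τ)) ∧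
                  0 ≤ M ∧ κ < 1 ∧ ∀ τ : ℝ, τ < 0 → ∀ x : EuclideanSpace ℝ (Fin 3), ‖u τ x‖ ≤ M * (-τ) ^ (-κ)) →
                (∀ t₀ : ℝ, t₀ < 0 → ∀ (x₀ : EuclideanSpace ℝ (Fin 3)) (δ W : ℝ), 0 < δ → δ < cylRadius x₀ →
                    (∀ x ∈ ball x₀ δ, ‖curl (u t₀) x‖ / cylRadius x ≤ W) →
                    ∀ t₁ : ℝ, t₁ < t₀ →
                      ∃ T : Set (EuclideanSpace ℝ (Fin 3)), MeasurableSet T ∧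
                        T ⊆ ball (0 : EuclideanSpace ℝ (Fin 3))
                          (‖x₀‖ + δ + M / (1 - κ) * ((-t₁) ^ (1 - κ) - (-t₀) ^ (1 - κ))) ∧
                        (∀ x ∈ T, ‖curl (u t₁) x‖ / cylRadius x ≤ W) ∧
                        ∫⁻ x in ball x₀ δ, ENNReal.ofReal (‖curl (u t₀) x‖ / cylRadius x) ≤
                          ∫⁻ x in T, ENNReal.ofReal (‖curl (u t₁) x‖ / cylRadius x)) →
                  Function.uncurry u =ᵐ[volume.restrict (Set.Iio (0 : ℝ) ×ˢ (Set.univ : Set (EuclideanSpace ℝ (Fin 3))))] 0 := by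
  intro hK2 ρ hρ hρ2 u p H c hcls M κ hκρ hstr hblob
  obtain ⟨hsw, hH, hgauge⟩ := hcls
  obtain ⟨hcl, _hsym, hM0, hκ1, _hM⟩ := hstr
  have hE : ∀ a : ℝ, 0 < a →
      ENNReal.ofReal (a ^ ρ) * cknE a (0 : ℝ × EuclideanSpace ℝ (Fin 3)) H ≤ (c : ℝ≥0∞) :=
    fun a ha => (le_add_self.trans le_self_add).trans (hgauge a ha)
  have hC2 : ∀ τ : ℝ, τ < 0 → ContDiff ℝ 2 (u τ) := fun τ hτ => (hcl.contDiff_velocity hτ).of_le (by norm_cast)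
  have hC1 : ∀ τ : ℝ, τ < 0 → ContDiff ℝ 1 (u τ) := fun τ hτ => (hcl.contDiff_velocity hτ).of_le (by norm_cast)
  have hdiv : ∀ τ : ℝ, τ < 0 → VectorCalculus.IsDivFree (u τ) := fun τ hτ => hcl.divFree τ hτ
  suffices hcurl : ∀ τ : ℝ, τ < 0 → ∀ x, curl (u τ) x = 0 from
    PastIrrotational.ae_eq_zero_of_gauge_of_pastIrrotational hρ hρ2 hsw hH hgauge (T₁ := 0) le_rfl hC2 hdiv hcurl
  intro t₀ ht₀
  by_contra hne
  push Not at hne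
  obtain ⟨x₁, hx₁⟩ := hne
  have hcont : Continuous (curl (u t₀)) := continuous_curl (hC1 t₀ ht₀)
  obtain ⟨x₀, hx₀, hc₀⟩ := exists_offAxis_of_curl_ne_zero hcont hx₁
  obtain ⟨δ, W, m, hδ, hδr, hW, hm, hηW, hmass⟩ := exists_blob_of_curl_ne_zero hcont hx₀ hc₀
  -- exponents: `γ = min 2 (1-κ)⁻¹ > 2 - ρ` (the exponent race), `ε = γ - (2 - ρ) > 0`
  have h1κ : 0 < 1 - κ := by linarith
  have hκ0 : 0 < κ := lt_trans (div_pos (by linarith) (by linarith)) hκρ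
  have hrace : 2 - ρ < (1 - κ)⁻¹ := by
    rw [← one_div, lt_div_iff₀ h1κ]
    have h := (div_lt_iff₀ (show (0 : ℝ) < 2 - ρ by linarith)).1 hκρ
    nlinarith
  obtain ⟨γ, hγ⟩ : ∃ γ : ℝ, γ = min 2 (1 - κ)⁻¹ := ⟨_, rfl⟩
  have hγ2 : γ ≤ 2 := by rw [hγ]; exact min_le_left _ _
  have hγκ : γ ≤ (1 - κ)⁻¹ := by rw [hγ]; exact min_le_right _ _
  have hγ1 : 1 ≤ γ := by
    rw [hγ]
    exact le_min (by norm_num) (by rw [← one_div, le_div_iff₀ h1κ]; linarith)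
  have hγρ : 2 - ρ < γ := by rw [hγ]; exact lt_min (by linarith) hrace
  have hε0 : 0 < γ - (2 - ρ) := by linarith
  -- constants
  obtain ⟨c₁, hc₁⟩ : ∃ c₁ : ℝ, c₁ = (1 - κ) / (4 * (M + 1)) := ⟨_, rfl⟩
  have hc₁0 : 0 < c₁ := by rw [hc₁]; positivity
  obtain ⟨c₂, hc₂⟩ : ∃ c₂ : ℝ, c₂ = min 1 (c₁ ^ (1 - κ)⁻¹) := ⟨_, rfl⟩
  have hc₂0 : 0 < c₂ := by rw [hc₂]; exact lt_min one_pos (Real.rpow_pos_of_pos hc₁0 _)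
  have hc₂1 : c₂ ≤ 1 := by rw [hc₂]; exact min_le_left _ _
  have hc₂c : c₂ ≤ c₁ ^ (1 - κ)⁻¹ := by rw [hc₂]; exact min_le_right _ _
  obtain ⟨K₁, hK₁⟩ : ∃ K₁ : ℝ, K₁ = 16 * π * (16 * (c : ℝ)) * (2 + |Real.log (W / m)| + 3) / (c₂ * m ^ 2) := ⟨_, rfl⟩
  -- a large radius `a`
  obtain ⟨a, haA, hlt⟩ :=
    ((eventually_ge_atTop (max (Real.exp 1) (max (2 * (‖x₀‖ + δ)) (2 * (-t₀) / c₂)))).and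
      (eventually_mul_log_lt_rpow hε0 K₁)).exists
  have hae : Real.exp 1 ≤ a := le_trans (le_max_left _ _) haA
  have haR : 2 * (‖x₀‖ + δ) ≤ a := le_trans ((le_max_left _ _).trans (le_max_right _ _)) haA
  have hat : 2 * (-t₀) / c₂ ≤ a := le_trans ((le_max_right _ _).trans (le_max_right _ _)) haA
  have ha1 : 1 ≤ a := le_trans (by have := Real.add_one_le_exp (1 : ℝ); linarith) hae
  have ha0 : 0 < a := by linarith
  have hloga : 1 ≤ Real.log a := by
    rw [Real.le_log_iff_exp_le ha0]
    exact hae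
  -- the usable window length `L_a`
  obtain ⟨La, hLa⟩ : ∃ La : ℝ, La = min (a ^ 2) ((c₁ * a) ^ (1 - κ)⁻¹) := ⟨_, rfl⟩
  have hLa_sq : La ≤ a ^ 2 := by rw [hLa]; exact min_le_left _ _
  have hLa_τ : La ≤ (c₁ * a) ^ (1 - κ)⁻¹ := by rw [hLa]; exact min_le_right _ _
  obtain ⟨hLa_ge, hLa_t₀⟩ : c₂ * a ^ γ ≤ La ∧ 2 * (-t₀) ≤ La := by
    rw [hLa]; exact window_length_bounds ha1 hc₁0 hc₂0 hc₂1 hc₂c hγ2 hγκ hγ1 hat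
  -- the floor on every slice of the usable window
  have hslice : ∀ t₁ ∈ Ioo (-La) t₀,
      ENNReal.ofReal (m ^ 2 / (8 * π * a * (2 + max 0 (Real.log (a ^ 3 * W / m))))) ≤
        ∫⁻ x in ball (0 : EuclideanSpace ℝ (Fin 3)) a, ENNReal.ofReal (‖curl (u t₁) x‖ ^ 2) := by
    intro t₁ ht₁
    obtain ⟨T, hTm, hTsub, hTW, hTmass⟩ := hblob t₀ ht₀ x₀ δ W hδ hδr hηW t₁ ht₁.2
    have hdrift : M / (1 - κ) * ((-t₁) ^ (1 - κ) - (-t₀) ^ (1 - κ)) ≤ a / 4 :=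
      drift_le_quarter hM0 h1κ hc₁ ha0 (by linarith [ht₁.2]) (by linarith) (by linarith [ht₁.1])
    have hTa : T ⊆ ball (0 : EuclideanSpace ℝ (Fin 3)) a := hTsub.trans (ball_subset_ball (by linarith))
    have ht₁0 : t₁ < 0 := lt_trans ht₁.2 ht₀
    exact (hK2 (u t₁) T a W m (hC1 t₁ ht₁0) ha0 hW hm hTm hTa hTW (hmass.trans hTmass)).trans
      (lintegral_mono_set hTa)
  -- integrate over the usable window and compare with the budget
  obtain ⟨Fa, hFa⟩ : ∃ Fa : ℝ, Fa = m ^ 2 / (8 * π * a * (2 + max 0 (Real.log (a ^ 3 * W / m)))) := ⟨_, rfl⟩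
  rw [← hFa] at hslice
  have hLg0 : 0 < 2 + max 0 (Real.log (a ^ 3 * W / m)) := by positivity
  have hFa0 : 0 < Fa := by rw [hFa]; positivity
  have hIoo : Ioo (-La) t₀ ⊆ Ioo (-a ^ 2) 0 := Ioo_subset_Ioo (by linarith) ht₀.le
  have hwin : ENNReal.ofReal (Fa * (t₀ - -La)) ≤ ENNReal.ofReal (16 * ((c : ℝ) * a ^ (1 - ρ))) := by
    calc ENNReal.ofReal (Fa * (t₀ - -La)) = ENNReal.ofReal Fa * ENNReal.ofReal (t₀ - -La) :=
          ENNReal.ofReal_mul hFa0.le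
      _ = ∫⁻ _ in Ioo (-La) t₀, ENNReal.ofReal Fa := by rw [setLIntegral_const, Real.volume_Ioo]
      _ ≤ ∫⁻ t₁ in Ioo (-La) t₀, ∫⁻ x in ball (0 : EuclideanSpace ℝ (Fin 3)) a, ENNReal.ofReal (‖curl (u t₁) x‖ ^ 2) :=
          setLIntegral_mono' measurableSet_Ioo hslice
      _ ≤ ∫⁻ t₁ in Ioo (-a ^ 2) 0, ∫⁻ x in ball (0 : EuclideanSpace ℝ (Fin 3)) a, ENNReal.ofReal (‖curl (u t₁) x‖ ^ 2) :=
          lintegral_mono_set hIoo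
      _ ≤ ENNReal.ofReal (16 * ((c : ℝ) * a ^ (1 - ρ))) := lintegral_window_sq_curl_le hH hcl hE ha0
  have hbudget : Fa * (t₀ + La) ≤ 16 * (c : ℝ) * a ^ (1 - ρ) := by
    have h := (ENNReal.ofReal_le_ofReal_iff (by positivity)).1 hwin
    have e : t₀ - -La = t₀ + La := by ring
    rw [e] at h
    linarith
  have hFa' : Fa * (8 * π * a * (2 + max 0 (Real.log (a ^ 3 * W / m)))) = m ^ 2 := by
    rw [hFa]
    field_simp
  -- the race
  have hfin := rpow_le_mul_log_of_floor_budget ha0 hm hc₂0 hLg0 (by positivity : (0 : ℝ) ≤ 16 * (c : ℝ)) hFa0 hFa'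
    hbudget hLa_t₀ hLa_ge (two_add_posLog_le ha0 hW hm hloga)
  rw [← hK₁] at hfin
  exact absurd hfin (not_le.2 hlt)

end Summit.NavierStokesRegularity.NavierStokesRegularity.Theorems.PowerGaugeEulerLiouville.CasimirFloor

end
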